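import Literature.NumberTheory.Rogawski1990.CartanObstruction
import Literature.NumberTheory.GaloisRepresentations.HasseNormEtaleInvolutionDescent
import HarnessLib

/-!
# The obstruction of a regular stable class of `U(H)`, INDICATOR READING: `cartanObsFun p 𝔪` is the quadratic norm-residue symbol of
# `K_𝔪 ∕ K_𝔪^τ` at the descended idèle of the `𝔪`-component of the adelic Cartan class (Rogawski 1990, §3.5 Prop. 3.5.2 (c); Kottwitz 1986 §9)

Topic `NumberTheory/Rogawski1990`; namespace `Literature.NumberTheory.Rogawski1990`; **THEOREMS ONLY** (no definition, no named fact, no instance,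
no notation, no `sorry`).  Cell `pub/hodgecm-mathlib`, ENGINE T1 (crux H413 = `stmt-HodgeConjecture-24833`), row G6, sub-row R6d (C, part 1) of
`BLUEPRINT-R6dR7-CartanObsHasse.F0P5a-p03g4` (0a35b92f): the factorwise definition ★ `MatchingAdeleG₂.cartanObsFun` (`CartanObstruction`, «is the
`𝔪`-component principal `τ`-fixed × norm?») READ in any presentation `π : L[γ₀] ↠ C` of the factor and identified with B-p12's ★ `quadraticArtinIndicator`
through A-p14's ★ `quadraticArtinIndicator_eq_zero_iff_exists_repr` (`HasseNormEtaleInvolutionDescent` ed. 2) — the input of the sum-zero theorem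
`∑_𝔪 cartanObsFun p 𝔪 = 0` (norm functoriality ★ `quadraticArtinIndicator_ideleRelNorm`, part 2).  HC_CM is proved only modulo the printed citations until
rung 0 closes.

THE PRINT.  [Rogawski1990, §3.5 Prop. 3.5.2 (c) p. 29]: `𝔈(T∕F) ≅ {(ε_j) ∈ ⊕_{j τ-stable} K_j^{τ,×}∕N(K_jˣ)-characters …}` — the `j`-th coordinate of the
obstruction of an adelic class is the quadratic norm-residue symbol of `K_j ∕ K_j^τ` evaluated at the `j`-component of its Cartan cocycle;
[CasselsFrohlichANT1967, Ch. VII §7.3 (a)]: `𝔸_{K^τ} = 𝔸_K^{τ}` (Galois descent of idèles).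

WHAT IS PROVED (CM letters of ★ `CartanObstruction`).
* `map_eq_map_iff_of_surjective_of_ker` — for `π : L[γ₀] ↠ C` with kernel `𝔪`, equations under `1 ⊗ π` are equations under `1 ⊗ mk_𝔪`
  (`L[γ₀] ∕ 𝔪 ≅ C` and `1 ⊗ ≅` is an isomorphism, Mathlib `Algebra.TensorProduct.congr`).
* **`isPrincipalNormAt_iff_exists_repr`** — `IsPrincipalNormAt … X 𝔪` in ANY presentation `π` of the factor: `∃ k u u′, π k ≠ 0 ∧ π (τ k) = π k ∧
  (1 ⊗ π)(u u′) = 1 ∧ (1 ⊗ π) X = (1 ⊗ π)((1 ⊗ k) u (1 ⊗ τ) u)` — the right-hand side of ★ `quadraticArtinIndicator_eq_zero_iff_exists_repr`.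
* **`MatchingAdeleG₂.cartanObsFun_eq_quadraticArtinIndicator`** — for a presentation `(C, π, τ_C)` of the τ-stable factor `𝔪` as a number field with
  involution (`C = C^{τ_C}(√d)` presented by `δ`) and the descended idèle `W ∈ 𝕀_{C^{τ_C}}` with `con W = Z_π(adelicCartanRepr p)`:
  `cartanObsFun p 𝔪 = [W]_{C^{τ_C}, d}`.

## References
* [Rogawski1990] J. D. Rogawski, *Automorphic Representations of Unitary Groups in Three Variables*, Ann. of Math. Stud. 123 (1990), §3.3 p. 22; §3.5
  Prop. 3.5.2 (c) p. 29.
* [Kottwitz1986] R. E. Kottwitz, *Stable trace formula: elliptic singular terms*, Math. Ann. 275 (1986), §9.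
* [CasselsFrohlichANT1967] Cassels–Fröhlich (eds.), *Algebraic Number Theory* (1967), Ch. II §14; Ch. VII §7.3 (a).
-/

set_option autoImplicit false

noncomputable section

open NumberField IsDedekindDomain Polynomial
open scoped TensorProduct Matrix MatrixGroups


namespace Literature.NumberTheory.Rogawski1990

open Literature.NumberTheory.Automorphic Literature.NumberTheory.GaloisRepresentations Literature.LinearAlgebra.Matrix
open Literature.AlgebraicGeometry.ShimuraVarieties (unitaryGroup mem_unitaryGroup_iff)

section Transport

variable {L : Type} [Field L] [NumberField L] [IsCMField L] {H : Matrix (Fin 3) (Fin 3) L} {γ₀ : (UnitaryGroup.cmDatum L 3 H).Rational}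

/-- For a surjection `π : L[γ₀] → C` with kernel `𝔪` there is an algebra isomorphism `e : L[γ₀] ∕ 𝔪 ≃ C` with `e ∘ mk_𝔪 = π`, and then
`(1 ⊗ π) = (1 ⊗ e) ∘ (1 ⊗ mk_𝔪)` with `1 ⊗ e` an isomorphism: equations under `1 ⊗ π` and under `1 ⊗ mk_𝔪` are the same (plumbing for reading
`IsPrincipalNormAt` in ANY presentation of the factor, as ★ R3′∕R3″ present factors). [cite: CasselsFrohlichANT1967, Ch. II §14] -/
theorem map_eq_map_iff_of_surjective_of_ker {C : Type} [CommRing C] [Algebra (↥(maximalRealSubfield L)) C]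
    (π : ↥(cartanSubalgebra γ₀) →ₐ[↥(maximalRealSubfield L)] C) (hπ : Function.Surjective π) (𝔪 : MaximalSpectrum ↥(cartanSubalgebra γ₀))
    (hker : ∀ b, π b = 0 ↔ b ∈ 𝔪.asIdeal) (x y : adelicCartanAlgebra γ₀) :
    Algebra.TensorProduct.map (AlgHom.id (AdeleRing (𝓞 ↥(maximalRealSubfield L)) ↥(maximalRealSubfield L)) (AdeleRing (𝓞 ↥(maximalRealSubfield L)) ↥(maximalRealSubfield L))) π x = Algebra.TensorProduct.map (AlgHom.id (AdeleRing (𝓞 ↥(maximalRealSubfield L)) ↥(maximalRealSubfield L)) (AdeleRing (𝓞 ↥(maximalRealSubfield L)) ↥(maximalRealSubfield L))) π y ↔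
      Algebra.TensorProduct.map (AlgHom.id (AdeleRing (𝓞 ↥(maximalRealSubfield L)) ↥(maximalRealSubfield L)) (AdeleRing (𝓞 ↥(maximalRealSubfield L)) ↥(maximalRealSubfield L))) (Ideal.Quotient.mkₐ (↥(maximalRealSubfield L)) 𝔪.asIdeal) x = Algebra.TensorProduct.map (AlgHom.id (AdeleRing (𝓞 ↥(maximalRealSubfield L)) ↥(maximalRealSubfield L)) (AdeleRing (𝓞 ↥(maximalRealSubfield L)) ↥(maximalRealSubfield L))) (Ideal.Quotient.mkₐ (↥(maximalRealSubfield L)) 𝔪.asIdeal) y := by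
  classical
  -- `e : L[γ₀] ∕ 𝔪 ≃ C`
  let e₀ : (↥(cartanSubalgebra γ₀) ⧸ 𝔪.asIdeal) →ₐ[↥(maximalRealSubfield L)] C := Ideal.Quotient.liftₐ 𝔪.asIdeal π (fun b hb => (hker b).2 hb)
  have he₀ : ∀ b, e₀ (Ideal.Quotient.mk 𝔪.asIdeal b) = π b := fun b => Ideal.Quotient.lift_mk 𝔪.asIdeal (π : ↥(cartanSubalgebra γ₀) →+* C) _
  have hinj : Function.Injective e₀ := by
    rw [injective_iff_map_eq_zero]
    intro q hq
    obtain ⟨b, rfl⟩ := Ideal.Quotient.mk_surjective q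
    rw [he₀] at hq
    exact Ideal.Quotient.eq_zero_iff_mem.2 ((hker b).1 hq)
  have hsurj : Function.Surjective e₀ := fun c => by
    obtain ⟨b, rfl⟩ := hπ c
    exact ⟨Ideal.Quotient.mk 𝔪.asIdeal b, he₀ b⟩
  let e : (↥(cartanSubalgebra γ₀) ⧸ 𝔪.asIdeal) ≃ₐ[↥(maximalRealSubfield L)] C := AlgEquiv.ofBijective e₀ ⟨hinj, hsurj⟩
  -- `1 ⊗ π = (1 ⊗ e) ∘ (1 ⊗ mk)`
  have hfac : Algebra.TensorProduct.map (AlgHom.id (AdeleRing (𝓞 ↥(maximalRealSubfield L)) ↥(maximalRealSubfield L)) (AdeleRing (𝓞 ↥(maximalRealSubfield L)) ↥(maximalRealSubfield L))) π =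
      ((Algebra.TensorProduct.congr (AlgEquiv.refl : (AdeleRing (𝓞 ↥(maximalRealSubfield L)) ↥(maximalRealSubfield L)) ≃ₐ[AdeleRing (𝓞 ↥(maximalRealSubfield L)) ↥(maximalRealSubfield L)] (AdeleRing (𝓞 ↥(maximalRealSubfield L)) ↥(maximalRealSubfield L))) e).toAlgHom).comp
        (Algebra.TensorProduct.map (AlgHom.id (AdeleRing (𝓞 ↥(maximalRealSubfield L)) ↥(maximalRealSubfield L)) (AdeleRing (𝓞 ↥(maximalRealSubfield L)) ↥(maximalRealSubfield L))) (Ideal.Quotient.mkₐ (↥(maximalRealSubfield L)) 𝔪.asIdeal)) := by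
    apply Algebra.TensorProduct.ext'
    intro a b
    rw [AlgHom.comp_apply, Algebra.TensorProduct.map_tmul, Algebra.TensorProduct.map_tmul]
    change _ = Algebra.TensorProduct.congr _ e (a ⊗ₜ Ideal.Quotient.mk 𝔪.asIdeal b)
    rw [Algebra.TensorProduct.congr_apply, Algebra.TensorProduct.map_tmul]
    change _ = _ ⊗ₜ e₀ (Ideal.Quotient.mk 𝔪.asIdeal b)
    rw [he₀]; rfl
  rw [hfac, AlgHom.comp_apply, AlgHom.comp_apply]
  exact (Algebra.TensorProduct.congr (AlgEquiv.refl : (AdeleRing (𝓞 ↥(maximalRealSubfield L)) ↥(maximalRealSubfield L)) ≃ₐ[AdeleRing (𝓞 ↥(maximalRealSubfield L)) ↥(maximalRealSubfield L)] (AdeleRing (𝓞 ↥(maximalRealSubfield L)) ↥(maximalRealSubfield L))) e).injective.eq_iff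

/-- **`IsPrincipalNormAt` in ANY presentation `π : L[γ₀] ↠ C` of the factor `𝔪 = ker π`**: «principal `τ`-fixed × norm at `𝔪`» iff
`∃ k u u′, π k ≠ 0 ∧ π (τ k) = π k ∧ (1 ⊗ π)(u u′) = 1 ∧ (1 ⊗ π) X = (1 ⊗ π)((1 ⊗ k) u (1 ⊗ τ) u)` — the right-hand side of ★
`quadraticArtinIndicator_eq_zero_iff_exists_repr` ∕ the hypothesis of ★ (D4). [cite: Rogawski1990, §3.5 Prop. 3.5.2 (c) p. 29] -/
theorem isPrincipalNormAt_iff_exists_repr (hH : (H.map (cmConjRingHom L))ᵀ = H) (hHd : IsUnit H.det)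
    (hreg : IsRegularElt ((γ₀ : unitaryGroup (cmConjRingHom L) H).val : GL (Fin 3) L)) (X : adelicCartanAlgebra γ₀)
    (𝔪 : MaximalSpectrum ↥(cartanSubalgebra γ₀)) {C : Type} [CommRing C] [Algebra (↥(maximalRealSubfield L)) C]
    (π : ↥(cartanSubalgebra γ₀) →ₐ[↥(maximalRealSubfield L)] C) (hπ : Function.Surjective π) (hker : ∀ b, π b = 0 ↔ b ∈ 𝔪.asIdeal) :
    IsPrincipalNormAt hH hHd hreg X 𝔪 ↔
      ∃ (k : ↥(cartanSubalgebra γ₀)) (u u' : adelicCartanAlgebra γ₀), π k ≠ 0 ∧ π (cartanInvolutionCM hH hHd hreg k) = π k ∧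
        Algebra.TensorProduct.map (AlgHom.id (AdeleRing (𝓞 ↥(maximalRealSubfield L)) ↥(maximalRealSubfield L)) (AdeleRing (𝓞 ↥(maximalRealSubfield L)) ↥(maximalRealSubfield L))) π (u * u') = 1 ∧
        Algebra.TensorProduct.map (AlgHom.id (AdeleRing (𝓞 ↥(maximalRealSubfield L)) ↥(maximalRealSubfield L)) (AdeleRing (𝓞 ↥(maximalRealSubfield L)) ↥(maximalRealSubfield L))) π X = Algebra.TensorProduct.map (AlgHom.id (AdeleRing (𝓞 ↥(maximalRealSubfield L)) ↥(maximalRealSubfield L)) (AdeleRing (𝓞 ↥(maximalRealSubfield L)) ↥(maximalRealSubfield L))) π ((1 : AdeleRing (𝓞 ↥(maximalRealSubfield L)) ↥(maximalRealSubfield L)) ⊗ₜ k * u *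
          Algebra.TensorProduct.map (AlgHom.id (AdeleRing (𝓞 ↥(maximalRealSubfield L)) ↥(maximalRealSubfield L)) (AdeleRing (𝓞 ↥(maximalRealSubfield L)) ↥(maximalRealSubfield L))) (cartanInvolutionCM hH hHd hreg : ↥(cartanSubalgebra γ₀) →ₐ[↥(maximalRealSubfield L)] ↥(cartanSubalgebra γ₀)) u) := by
  have hk0 : ∀ k : ↥(cartanSubalgebra γ₀), π k ≠ 0 ↔ k ∉ 𝔪.asIdeal := fun k => not_congr (hker k)
  have hkτ : ∀ k : ↥(cartanSubalgebra γ₀), π (cartanInvolutionCM hH hHd hreg k) = π k ↔ cartanInvolutionCM hH hHd hreg k - k ∈ 𝔪.asIdeal := fun k => by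
    rw [← hker, map_sub, sub_eq_zero]
  have h1 : ∀ z : adelicCartanAlgebra γ₀, Algebra.TensorProduct.map (AlgHom.id (AdeleRing (𝓞 ↥(maximalRealSubfield L)) ↥(maximalRealSubfield L)) (AdeleRing (𝓞 ↥(maximalRealSubfield L)) ↥(maximalRealSubfield L))) π z = 1 ↔ Algebra.TensorProduct.map (AlgHom.id (AdeleRing (𝓞 ↥(maximalRealSubfield L)) ↥(maximalRealSubfield L)) (AdeleRing (𝓞 ↥(maximalRealSubfield L)) ↥(maximalRealSubfield L))) (Ideal.Quotient.mkₐ (↥(maximalRealSubfield L)) 𝔪.asIdeal) z = 1 := fun z => by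
    have h := map_eq_map_iff_of_surjective_of_ker π hπ 𝔪 hker z 1
    rwa [map_one, map_one] at h
  unfold IsPrincipalNormAt
  refine exists_congr fun k => exists_congr fun u => exists_congr fun u' => ?_
  rw [hk0, hkτ, h1, map_eq_map_iff_of_surjective_of_ker π hπ 𝔪 hker]

end Transport

section Indicator

open scoped NumberField.AdeleRing
open Literature.NumberTheory.AdelicBaseChange

variable {L : Type} [Field L] [NumberField L] [IsCMField L] {H : Matrix (Fin 3) (Fin 3) L} {γ₀ : (UnitaryGroup.cmDatum L 3 H).Rational}

/-- **`cartanObsFun p 𝔪` IS the quadratic norm-residue indicator of the descended idèle** [Rogawski1990, Prop. 3.5.2 (c)]: for any presentation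
`π : L[γ₀] ↠ C` of the τ-stable factor `𝔪 = ker π` as a number field with involution `τ_C` (`π ∘ τ = τ_C ∘ π`, `C = C^{τ_C}(√d)` presented by `δ`),
and any idèle `W` of the fixed field `K₀ = C^{τ_C}` whose base change is the `π`-component `Z_π(X)` of the adelic Cartan class `X = adelicCartanRepr p`,
`cartanObsFun p 𝔪 = [W]_{K₀, d}` (★ A-p14 `quadraticArtinIndicator_eq_zero_iff_exists_repr` + `isPrincipalNormAt_iff_exists_repr`).
[cite: Rogawski1990, §3.5 Prop. 3.5.2 (c) p. 29; §3.3 p. 22] [cite: CasselsFrohlichANT1967, Ch. VII §7.3 (a)] -/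
theorem MatchingAdeleG₂.cartanObsFun_eq_quadraticArtinIndicator (hH : (H.map (cmConjRingHom L))ᵀ = H) (hHd : IsUnit H.det)
    (hreg : IsRegularElt ((γ₀ : unitaryGroup (cmConjRingHom L) H).val : GL (Fin 3) L)) (p : MatchingAdeleG₂ L H H γ₀)
    (𝔪 : cartanIndexCM hH hHd hreg) {C : Type} [Field C] [NumberField C] [Algebra (↥(maximalRealSubfield L)) C] (τ : C ≃ₐ[↥(maximalRealSubfield L)] C)
    (π : ↥(cartanSubalgebra γ₀) →ₐ[↥(maximalRealSubfield L)] C) (hτπ : ∀ b, π (cartanInvolutionCM hH hHd hreg b) = τ (π b))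
    (hπ : Function.Surjective π) (hker : ∀ b, π b = 0 ↔ b ∈ 𝔪.1.asIdeal)
    [IsGalois (IntermediateField.fixedField (Subgroup.zpowers τ)) C] (hτ : τ * τ = 1) (hτ1 : τ ≠ 1)
    {δ : C} (hδ : τ δ = -δ) (hδ0 : δ ≠ 0) {d : ↥(IntermediateField.fixedField (Subgroup.zpowers τ))}
    (hd : δ * δ = algebraMap (↥(IntermediateField.fixedField (Subgroup.zpowers τ))) C d)
    (W : (AdeleRing (𝓞 ↥(IntermediateField.fixedField (Subgroup.zpowers τ))) ↥(IntermediateField.fixedField (Subgroup.zpowers τ)))ˣ)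
    (hW : AdeleRing.ideleBaseChange (↥(IntermediateField.fixedField (Subgroup.zpowers τ))) C W =
      Units.map ((adeleRingTensorAlgEquiv (↥(maximalRealSubfield L)) C).toAlgHom.comp (Algebra.TensorProduct.map (AlgHom.id (AdeleRing (𝓞 ↥(maximalRealSubfield L)) ↥(maximalRealSubfield L)) (AdeleRing (𝓞 ↥(maximalRealSubfield L)) ↥(maximalRealSubfield L))) π)).toRingHom.toMonoidHom (p.adelicCartanRepr hH hHd hreg)) :
    p.cartanObsFun hH hHd hreg 𝔪 = quadraticArtinIndicator (↥(IntermediateField.fixedField (Subgroup.zpowers τ))) d W := by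
  have hiff : p.cartanObsFun hH hHd hreg 𝔪 = 0 ↔ quadraticArtinIndicator (↥(IntermediateField.fixedField (Subgroup.zpowers τ))) d W = 0 := by
    rw [p.cartanObsFun_eq_zero_iff hH hHd hreg 𝔪, isPrincipalNormAt_iff_exists_repr hH hHd hreg _ 𝔪.1 π hπ hker,
      quadraticArtinIndicator_eq_zero_iff_exists_repr τ (cartanInvolutionCM hH hHd hreg) π hτπ hτ hτ1 hπ hδ hδ0 hd _ W hW]
  rcases p.cartanObsFun_eq_zero_or_eq_one hH hHd hreg 𝔪 with h0 | h1
  · rw [h0]; exact (hiff.1 h0).symm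
  · rw [h1]
    by_cases h0' : quadraticArtinIndicator (↥(IntermediateField.fixedField (Subgroup.zpowers τ))) d W = 0
    · exact absurd (hiff.2 h0') (by rw [h1]; exact one_ne_zero)
    · exact (quadraticArtinIndicator_eq_one_iff.2 (fun hmem => h0' (quadraticArtinIndicator_eq_zero_iff.2 hmem))).symm

end Indicator

end Literature.NumberTheory.Rogawski1990

end
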